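import Mathlib
import Summits.ValiantsHypothesis.ValiantsHypothesis.Theses.BarrierLever
import Summits.ValiantsHypothesis.ValiantsHypothesis.Theorems.BarrierLeverTransversalResultantKernelNonsingularTropical

/-!
# Route BarrierLever — conjecture CT (stmt-ValiantsHypothesis-19179): the TWO-SIDED (bi-star)
# tropical certificate

`ResultantKernel.det_resultantMatrix_ne_zero_of_unique_assignment` (the one-sided certificate)
degenerates row parameters onto column parameters (`p_x → q_{μ x}`). Here both directions are
allowed at once: a map `μ : ι → Option κ` (row literal `x` collides with column literal `μ x`,
weight `wt x`) AND a map `ν : κ → Option ι` (column literal `y` collides with row literal `ν y`,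
weight `wt' y`), CONSISTENT in the sense that a collision target is never itself collided
(`μ x = some y → ν y = none` and `ν y = some x → μ x = none`; in valuation language: a forest of
stars on the parameters, centred on either side). The pair order is
`ord i j = Σ_{a,c} ([μ (R i a) = some (S j c)]·wt (R i a) + [ν (S j c) = some (R i a)]·wt' (S j c))`
and again a UNIQUE optimal assignment forces `det M ≠ 0` at some complex point
(`det_resultantMatrix_ne_zero_of_unique_biassignment`), with the CT-shaped corollary
`resultantKernel_layout_ne_zero_of_unique_biassignment`.

Construction: bases `8·enc x + 1` for row parameters and `8·enc' y + 4` for column parameters;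
`p_x := base(q_{μ x}) + ε^{wt x}` resp. `base(p_x)`; `q_y := base(p_{ν y}) + ε^{wt' y}` resp.
`base(q_y)`; every factor `p_x − q_y` is `± ε^{e}` on a star edge and has a nonzero constant term
otherwise (residues mod 8), so the Leibniz coefficient of `ε^{cost π₀}` is `± ∏ (nonzero)`.

WHAT THIS IS NOT: not a proof of CT; general ultrametric trees / non-unique leading terms are
still outside this certificate format.
-/

-- layout Summits/ValiantsHypothesis/ValiantsHypothesis forces the duplicated namespace component
set_option linter.dupNamespace false

open Polynomial Finset

namespace Summit.ValiantsHypothesis.ValiantsHypothesis.Theorems.BarrierLever.ResultantKernel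

/-- **Two-sided tropical certificate.** For resultant-type matrices
`M[i,j] = ∏_{a,c} (p (R i a) − q (S j c))`, consistent star-forest degeneration data `(μ, wt, ν, wt')`
whose assignment problem has a unique minimiser force `det M ≠ 0` for some `p, q`. -/
theorem det_resultantMatrix_ne_zero_of_unique_biassignment
    {ι κ α γ : Type*} [Fintype α] [Fintype γ] [DecidableEq ι] [DecidableEq κ] {r : ℕ}
    (R : Fin r → α → ι) (S : Fin r → γ → κ)
    (μ : ι → Option κ) (wt : ι → ℕ) (ν : κ → Option ι) (wt' : κ → ℕ)
    (hμν : ∀ x y, μ x = some y → ν y = none) (hνμ : ∀ y x, ν y = some x → μ x = none)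
    (enc : ι → ℕ) (henc : Function.Injective enc) (enc' : κ → ℕ) (henc' : Function.Injective enc')
    (ord : Fin r → Fin r → ℕ)
    (hord : ∀ i j, ord i j = ∑ a, ∑ c,
      ((if μ (R i a) = some (S j c) then wt (R i a) else 0)
        + (if ν (S j c) = some (R i a) then wt' (S j c) else 0)))
    (π₀ : Equiv.Perm (Fin r))
    (huniq : ∀ σ : Equiv.Perm (Fin r), σ ≠ π₀ → ∑ j, ord (π₀ j) j < ∑ j, ord (σ j) j) :
    ∃ p : ι → ℂ, ∃ q : κ → ℂ,
      (Matrix.of fun i j : Fin r => ∏ a, ∏ c, (p (R i a) - q (S j c))).det ≠ 0 := by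
  classical
  -- bases: row parameters ≡ 1, column parameters ≡ 4 (mod 8)
  set bP : ι → ℕ := fun x => 8 * enc x + 1 with hbP
  set bQ : κ → ℕ := fun y => 8 * enc' y + 4 with hbQ
  set pP : ι → ℂ[X] := fun x => match μ x with
    | some y => C ((bQ y : ℕ) : ℂ) + X ^ wt x
    | none => C ((bP x : ℕ) : ℂ) with hpP
  set qP : κ → ℂ[X] := fun y => match ν y with
    | some x => C ((bP x : ℕ) : ℂ) + X ^ wt' y
    | none => C ((bQ y : ℕ) : ℂ) with hqP
  -- exponents and cofactors per factor
  set e : ι → κ → ℕ := fun x y =>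
    (if μ x = some y then wt x else 0) + (if ν y = some x then wt' y else 0) with he
  set g : ι → κ → ℂ[X] := fun x y =>
    if μ x = some y then 1 else if ν y = some x then -1 else pP x - qP y with hg
  have hfac : ∀ x y, pP x - qP y = X ^ e x y * g x y := by
    intro x y
    by_cases hxy : μ x = some y
    · have hνy : ν y = none := hμν x y hxy
      simp only [he, hg, hxy, if_true, hpP, hqP, hνy]
      simp
    · by_cases hyx : ν y = some x
      · have hμx : μ x = none := hνμ y x hyx
        simp only [he, hg, hyx, if_true, hpP, hqP, hμx]
        simp
      · simp only [he, hg, hxy, hyx, if_false, add_zero, pow_zero, one_mul]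
  -- the constant terms of the cofactors are nonzero
  have hval : ∀ x y, ¬ μ x = some y → ¬ ν y = some x → (pP x - qP y).eval 0 ≠ 0 := by
    intro x y hxy hyx
    have key : ∀ A B : ℕ, ((A : ℂ) - (B : ℂ) = 0) → A = B :=
      fun A B h0 => Nat.cast_injective (sub_eq_zero.1 h0)
    have hzx : ((0 : ℂ) ^ wt x) = ((if wt x = 0 then 1 else 0 : ℕ) : ℂ) := by
      split_ifs with hw
      · rw [hw, pow_zero, Nat.cast_one]
      · rw [zero_pow hw, Nat.cast_zero]
    have hzy : ((0 : ℂ) ^ wt' y) = ((if wt' y = 0 then 1 else 0 : ℕ) : ℂ) := by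
      split_ifs with hw
      · rw [hw, pow_zero, Nat.cast_one]
      · rw [zero_pow hw, Nat.cast_zero]
    rcases hμx : μ x with _ | y' <;> rcases hνy : ν y with _ | x'
    · -- free row parameter vs free column parameter: 8a+1 vs 8b+4
      simp only [hpP, hqP, hμx, hνy, eval_sub, eval_C]
      intro h0
      have h1 := key _ _ h0
      simp only [hbP, hbQ] at h1
      omega
    · -- free row parameter vs column leaf attached to p_{x'}, x' ≠ x
      have hne : enc x' ≠ enc x := fun h' => hyx (by rw [hνy, henc h'])
      simp only [hpP, hqP, hμx, hνy, eval_sub, eval_add, eval_C, eval_pow, eval_X, hzy]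
      rw [← Nat.cast_add]
      intro h0
      have h1 := key _ _ h0
      simp only [hbP] at h1
      split_ifs at h1 <;> omega
    · -- row leaf attached to q_{y'}, y' ≠ y, vs free column parameter
      have hne : enc' y' ≠ enc' y := fun h' => hxy (by rw [hμx, henc' h'])
      simp only [hpP, hqP, hμx, hνy, eval_sub, eval_add, eval_C, eval_pow, eval_X, hzx]
      rw [← Nat.cast_add]
      intro h0
      have h1 := key _ _ h0
      simp only [hbQ] at h1
      split_ifs at h1 <;> omega
    · -- row leaf (base ≡ 4 or 5) vs column leaf (base ≡ 1 or 2)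
      simp only [hpP, hqP, hμx, hνy, eval_sub, eval_add, eval_C, eval_pow, eval_X, hzx, hzy]
      rw [← Nat.cast_add, ← Nat.cast_add]
      intro h0
      have h1 := key _ _ h0
      simp only [hbP, hbQ] at h1
      split_ifs at h1 <;> omega
  have hg0 : ∀ x y, (g x y).eval 0 ≠ 0 := by
    intro x y
    by_cases hxy : μ x = some y
    · simp [hg, hxy]
    · by_cases hyx : ν y = some x
      · simp [hg, hxy, hyx]
      · simp only [hg, hxy, hyx, if_false]
        exact hval x y hxy hyx
  -- the matrix over ℂ[ε] and its entries
  set Mε : Matrix (Fin r) (Fin r) ℂ[X] :=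
    Matrix.of fun i j => ∏ a, ∏ c, (pP (R i a) - qP (S j c)) with hMε
  set G : Fin r → Fin r → ℂ[X] := fun i j => ∏ a, ∏ c, g (R i a) (S j c) with hG
  have hentry : ∀ i j, Mε i j = X ^ ord i j * G i j := by
    intro i j
    rw [hMε, Matrix.of_apply, hord i j, hG]
    simp only
    simp_rw [hfac]
    simp_rw [prod_X_pow_mul]
    rfl
  have hG0 : ∀ i j, (G i j).eval 0 ≠ 0 := by
    intro i j
    rw [hG]
    simp only [eval_prod]
    exact Finset.prod_ne_zero_iff.2 fun a _ => Finset.prod_ne_zero_iff.2 fun c _ => hg0 _ _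
  -- the coefficient of ε^{cost π₀} in det Mε
  set m₀ : ℕ := ∑ j, ord (π₀ j) j with hm₀
  have hcoeff : Mε.det.coeff m₀ =
      ((Equiv.Perm.sign π₀ : ℤ) : ℂ) * ∏ j, (G (π₀ j) j).eval 0 := by
    rw [Matrix.det_apply', finsetSum_coeff]
    rw [Finset.sum_eq_single π₀]
    · rw [show (((Equiv.Perm.sign π₀ : ℤ)) : ℂ[X]) = C ((Equiv.Perm.sign π₀ : ℤ) : ℂ) from
        (map_intCast (Polynomial.C : ℂ →+* ℂ[X]) _).symm, coeff_C_mul]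
      congr 1
      simp_rw [hentry]
      rw [prod_X_pow_mul, coeff_X_pow_mul', if_pos (le_of_eq hm₀.symm), hm₀, Nat.sub_self,
        coeff_zero_eq_eval_zero, eval_prod]
    · intro σ _ hσ
      rw [show (((Equiv.Perm.sign σ : ℤ)) : ℂ[X]) = C ((Equiv.Perm.sign σ : ℤ) : ℂ) from
        (map_intCast (Polynomial.C : ℂ →+* ℂ[X]) _).symm, coeff_C_mul]
      simp_rw [hentry]
      rw [prod_X_pow_mul, coeff_X_pow_mul', if_neg (not_le.2 (huniq σ hσ)), mul_zero]
    · intro h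
      exact absurd (Finset.mem_univ π₀) h
  have hdet : Mε.det ≠ 0 := by
    intro hz
    have h1 := hcoeff
    rw [hz, coeff_zero] at h1
    refine mul_ne_zero ?_ (Finset.prod_ne_zero_iff.2 fun j _ => hG0 _ _) h1.symm
    exact Int.cast_ne_zero.2 (Units.ne_zero _)
  -- evaluate at a non-root
  obtain ⟨z, hz⟩ := exists_eval_ne_zero_of_ne_zero hdet
  refine ⟨fun i => (pP i).eval z, fun k => (qP k).eval z, ?_⟩
  have heval : (Matrix.of fun i j : Fin r =>
      ∏ a, ∏ c, ((pP (R i a)).eval z - (qP (S j c)).eval z)).det = Mε.det.eval z := by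
    rw [hMε, ← Polynomial.coe_evalRingHom, RingHom.map_det]
    congr 1
    ext i j
    simp only [RingHom.mapMatrix_apply, Matrix.map_apply, Matrix.of_apply,
      Polynomial.coe_evalRingHom, eval_prod, eval_sub]
  rw [heval]
  exact hz

/-- **Two-sided certificate ⇒ CT for one layout.** -/
theorem resultantKernel_layout_ne_zero_of_unique_biassignment
    (h r : ℕ) (u w : Fin r → Finset (Fin h))
    (μ : Fin (h + h) → Option (Fin (h + h))) (wt : Fin (h + h) → ℕ)
    (ν : Fin (h + h) → Option (Fin (h + h))) (wt' : Fin (h + h) → ℕ)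
    (hμν : ∀ x y, μ x = some y → ν y = none) (hνμ : ∀ y x, ν y = some x → μ x = none)
    (ord : Fin r → Fin r → ℕ)
    (hord : ∀ i j, ord i j = ∑ a : Fin h, ∑ c : Fin h,
      ((if μ (if a ∈ u i then Fin.castAdd h a else Fin.natAdd h a)
            = some (if c ∈ w j then Fin.natAdd h c else Fin.castAdd h c)
        then wt (if a ∈ u i then Fin.castAdd h a else Fin.natAdd h a) else 0)
      + (if ν (if c ∈ w j then Fin.natAdd h c else Fin.castAdd h c)
            = some (if a ∈ u i then Fin.castAdd h a else Fin.natAdd h a)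
        then wt' (if c ∈ w j then Fin.natAdd h c else Fin.castAdd h c) else 0)))
    (π₀ : Equiv.Perm (Fin r))
    (huniq : ∀ σ : Equiv.Perm (Fin r), σ ≠ π₀ → ∑ j, ord (π₀ j) j < ∑ j, ord (σ j) j) :
    ∃ p q : Fin (h + h) → ℂ, (Matrix.of fun i j : Fin r => ∏ a : Fin h, ∏ c : Fin h,
      (p (if a ∈ u i then Fin.castAdd h a else Fin.natAdd h a)
        - q (if c ∈ w j then Fin.natAdd h c else Fin.castAdd h c))).det ≠ 0 :=
  det_resultantMatrix_ne_zero_of_unique_biassignment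
    (fun i a => if a ∈ u i then Fin.castAdd h a else Fin.natAdd h a)
    (fun j c => if c ∈ w j then Fin.natAdd h c else Fin.castAdd h c)
    μ wt ν wt' hμν hνμ Fin.val Fin.val_injective Fin.val Fin.val_injective ord hord π₀ huniq

end Summit.ValiantsHypothesis.ValiantsHypothesis.Theorems.BarrierLever.ResultantKernel
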